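import Summits.AtomisticToContinuum.Crystallization.Theorems.FrustratedLawDichotomyStrainedPatchHomLeafVectorForm

/-!
# Leaf soundness, VECTOR FORM — the MOMENT IDENTITY and the first+second-order functional bound (def-free)

decomp-a2c hand-2 g25 (crux `AperiodicFrustratedLawGap`, stmt-AtomisticToContinuum-27623; (H) hcp P-twin, critic rows 887/891/893).  The hypothesis
`hF : −PEN ≤ Σ_v D̂_v (q_v − q̂_v)` of `…HomLeafVectorForm.leaf_sound_vector_form`, discharged from the MOMENTS of the weighted label family:
with `Δ = V − V̂`, `δ = η − η̂`, `K_a = Σ_c V_ac δ_c`, `Γ_cc' = Σ_v D_v z_vc z_vc'`, `γ_c = Σ_v D_v u_v z_vc`, `C = Σ_v D_v u_v` (`u_v ∈ {0,1}`),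

★ `moment_identity`:
`Σ_v D_v (‖V(z_v + u_v δ)‖² − ‖V̂ z_v‖²) = Σ_a [2 Σ_c Δ_ac (V̂Γ)_ac + 2 K_a (V̂γ)_a + Σ_cc' Δ_ac Δ_ac' Γ_cc' + 2 K_a (Δγ)_a + C K_a²]`
(a polynomial identity; the label dependence enters only through `Γ, γ, C` — for the hcp checker these are fixed integer combinations of the ten
class gradients), and ★★ `functional_lower_bound`: on the box `|Δ| ≤ Ŵ`, `|δ| ≤ Ŵη` the functional is
`≥ −[2ΣΣ Ŵ_ac |(V̂Γ)_ac| + 2Σ Ŵη_c |(V̂ᵀV̂γ)_c| + 2Σ|(V̂γ)_a| X_a + ΣΣΣ Ŵ_acŴ_ac'|Γ_cc'| + 2Σ(Σ_c Ŵ_ac|γ_c|) Y_a + |C| Σ Y_a²]`,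
`X_a = Σ_c Ŵ_ac Ŵη_c`, `Y_a = Σ_c (|V̂_ac| + Ŵ_ac) Ŵη_c` — the real reading of the checker's `T1 … T6` (`T4`, `T6` there carry an extra factor `2`).
No definitions; 0 sorry; standard axioms.  `--supports stmt-AtomisticToContinuum-27623`.
-/

noncomputable section

namespace Summit.AtomisticToContinuum.Crystallization.Theorems.FrustratedLawDichotomyStrainedPatchHomLeafVectorForm

open scoped BigOperators
open Set Finset
open Summit.AtomisticToContinuum.Crystallization.Theorems.FrustratedLawDichotomyStrainedPatchHomLeafPointsParam (abs_linear_le neg_sum_abs_mul_le)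

/-! ## §1. The moment identity -/

/-- The per-label expansion: `‖V(z + uδ)‖² − ‖V̂ z‖²` as a polynomial in `Δ = V − V̂`, `K = Vδ`, `V̂`, `z`, `u` (`u ∈ {0,1}`). [formal bookkeeping] -/
theorem label_expansion (V V₀ : Fin 3 → Fin 3 → ℝ) (η η₀ z : Fin 3 → ℝ) (u D : ℝ) (hu : u = 0 ∨ u = 1) :
    D * (∑ a, (∑ c, V a c * (z c + u * (η c - η₀ c))) ^ 2 - ∑ a, (∑ c, V₀ a c * z c) ^ 2) =
      ∑ a, (2 * ∑ c, (V a c - V₀ a c) * ∑ c', V₀ a c' * (D * (z c' * z c))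
        + 2 * (∑ c, V a c * (η c - η₀ c)) * ∑ c, V₀ a c * (D * (u * z c))
        + ∑ c, ∑ c', (V a c - V₀ a c) * (V a c' - V₀ a c') * (D * (z c * z c'))
        + 2 * (∑ c, V a c * (η c - η₀ c)) * ∑ c, (V a c - V₀ a c) * (D * (u * z c))
        + D * u * (∑ c, V a c * (η c - η₀ c)) ^ 2) := by
  rcases hu with rfl | rfl <;> · simp only [Fin.sum_univ_three]; ring

/-- ★ **THE MOMENT IDENTITY** (moments written as explicit sums over `S`). [folklore: polynomial bookkeeping] -/
theorem moment_identity {ι : Type*} (S : Finset ι) (D : ι → ℝ) (z : ι → Fin 3 → ℝ) (u : ι → ℝ) (hu : ∀ l ∈ S, u l = 0 ∨ u l = 1)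
    (V V₀ : Fin 3 → Fin 3 → ℝ) (η η₀ : Fin 3 → ℝ) :
    ∑ l ∈ S, D l * (∑ a, (∑ c, V a c * (z l c + u l * (η c - η₀ c))) ^ 2 - ∑ a, (∑ c, V₀ a c * z l c) ^ 2) =
      ∑ a, (2 * ∑ c, (V a c - V₀ a c) * ∑ c', V₀ a c' * (∑ l ∈ S, D l * (z l c' * z l c))
        + 2 * (∑ c, V a c * (η c - η₀ c)) * ∑ c, V₀ a c * (∑ l ∈ S, D l * (u l * z l c))
        + ∑ c, ∑ c', (V a c - V₀ a c) * (V a c' - V₀ a c') * (∑ l ∈ S, D l * (z l c * z l c'))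
        + 2 * (∑ c, V a c * (η c - η₀ c)) * ∑ c, (V a c - V₀ a c) * (∑ l ∈ S, D l * (u l * z l c))
        + (∑ l ∈ S, D l * u l) * (∑ c, V a c * (η c - η₀ c)) ^ 2) := by
  classical
  induction S using Finset.induction_on with
  | empty => simp
  | @insert l S hl ih =>
    have hul : u l = 0 ∨ u l = 1 := hu l (Finset.mem_insert_self l S)
    have huS : ∀ l' ∈ S, u l' = 0 ∨ u l' = 1 := fun l' hl' => hu l' (Finset.mem_insert_of_mem hl')
    rw [Finset.sum_insert hl, ih huS, label_expansion V V₀ η η₀ (z l) (u l) (D l) hul]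
    simp only [Finset.sum_insert hl, Fin.sum_univ_three]
    ring

/-! ## §2. ★★ The functional lower bound -/

/-- `−(Σ_c w_c |g_c|) ≤ Σ_c x_c g_c` for `|x_c| ≤ w_c` (product order swapped). [formal bookkeeping] -/
theorem neg_sum_le_sum_mul {n : ℕ} (g x w : Fin n → ℝ) (hx : ∀ i, |x i| ≤ w i) : -∑ i, w i * |g i| ≤ ∑ i, x i * g i := by
  have h := neg_sum_abs_mul_le g x w hx
  have e1 : ∑ i, w i * |g i| = ∑ i, |g i| * w i := Finset.sum_congr rfl fun i _ => mul_comm _ _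
  have e2 : ∑ i, x i * g i = ∑ i, g i * x i := Finset.sum_congr rfl fun i _ => mul_comm _ _
  rw [e1, e2]; exact h

/-- `|Σ_c x_c g_c| ≤ Σ_c w_c |g_c|` for `|x_c| ≤ w_c`. [formal bookkeeping] -/
theorem abs_sum_mul_le {n : ℕ} (g x w : Fin n → ℝ) (hx : ∀ i, |x i| ≤ w i) : |∑ i, x i * g i| ≤ ∑ i, w i * |g i| := by
  refine (abs_sum_le_sum_abs _ _).trans (Finset.sum_le_sum fun i _ => ?_)
  rw [abs_mul]; exact mul_le_mul_of_nonneg_right (hx i) (abs_nonneg _)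

/-- ★★ **THE FUNCTIONAL LOWER BOUND** (moments as variables with their defining equations). [folklore] -/
theorem functional_lower_bound {ι : Type*} (S : Finset ι) (D : ι → ℝ) (z : ι → Fin 3 → ℝ) (u : ι → ℝ)
    (hu : ∀ l ∈ S, u l = 0 ∨ u l = 1) (V V₀ W : Fin 3 → Fin 3 → ℝ) (η η₀ Wη : Fin 3 → ℝ)
    (hV : ∀ a c, |V a c - V₀ a c| ≤ W a c) (hη : ∀ c, |η c - η₀ c| ≤ Wη c)
    (Γ : Fin 3 → Fin 3 → ℝ) (γ : Fin 3 → ℝ) (C : ℝ) (hΓ : ∀ c c', Γ c c' = ∑ l ∈ S, D l * (z l c * z l c'))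
    (hγ : ∀ c, γ c = ∑ l ∈ S, D l * (u l * z l c)) (hC : C = ∑ l ∈ S, D l * u l) :
    -(2 * ∑ a, ∑ c, W a c * |∑ c', V₀ a c' * Γ c' c|
        + 2 * ∑ c, Wη c * |∑ a, V₀ a c * ∑ c', V₀ a c' * γ c'|
        + 2 * ∑ a, |∑ c, V₀ a c * γ c| * ∑ c, W a c * Wη c
        + ∑ a, ∑ c, ∑ c', W a c * W a c' * |Γ c c'|
        + 2 * ∑ a, (∑ c, W a c * |γ c|) * ∑ c, (|V₀ a c| + W a c) * Wη c
        + |C| * ∑ a, (∑ c, (|V₀ a c| + W a c) * Wη c) ^ 2) ≤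
      ∑ l ∈ S, D l * (∑ a, (∑ c, V a c * (z l c + u l * (η c - η₀ c))) ^ 2 - ∑ a, (∑ c, V₀ a c * z l c) ^ 2) := by
  have hW : ∀ a c, 0 ≤ W a c := fun a c => (abs_nonneg _).trans (hV a c)
  have hWη : ∀ c, 0 ≤ Wη c := fun c => (abs_nonneg _).trans (hη c)
  -- rewrite the functional by the moment identity, with the moments named
  have hid := moment_identity S D z u hu V V₀ η η₀
  have hΓ' : ∀ c c', ∑ l ∈ S, D l * (z l c * z l c') = Γ c c' := fun c c' => (hΓ c c').symm
  have hγ' : ∀ c, ∑ l ∈ S, D l * (u l * z l c) = γ c := fun c => (hγ c).symm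
  simp only [hΓ', hγ', ← hC] at hid
  rw [hid]
  -- abbreviations
  set Δ : Fin 3 → Fin 3 → ℝ := fun a c => V a c - V₀ a c with hΔ
  set K : Fin 3 → ℝ := fun a => ∑ c, V a c * (η c - η₀ c) with hK
  set Y : Fin 3 → ℝ := fun a => ∑ c, (|V₀ a c| + W a c) * Wη c with hY
  have hΔb : ∀ a c, |Δ a c| ≤ W a c := hV
  -- |K_a| ≤ Y_a
  have hKY : ∀ a, |K a| ≤ Y a := by
    intro a
    refine (abs_sum_le_sum_abs _ _).trans (Finset.sum_le_sum fun c _ => ?_)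
    rw [abs_mul]
    have hVa : |V a c| ≤ |V₀ a c| + W a c := by
      have := hV a c
      calc |V a c| = |V₀ a c + (V a c - V₀ a c)| := by ring_nf
        _ ≤ |V₀ a c| + |V a c - V₀ a c| := abs_add_le _ _
        _ ≤ |V₀ a c| + W a c := by linarith
    exact mul_le_mul hVa (hη c) (abs_nonneg _) ((abs_nonneg _).trans hVa)
  have hY0 : ∀ a, 0 ≤ Y a := fun a => (abs_nonneg _).trans (hKY a)
  -- K_a = Σ_c V₀_ac δ_c + Σ_c Δ_ac δ_c
  have hKsplit : ∀ a, K a = ∑ c, V₀ a c * (η c - η₀ c) + ∑ c, Δ a c * (η c - η₀ c) := by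
    intro a; simp only [hK, hΔ, ← Finset.sum_add_distrib]; exact Finset.sum_congr rfl fun c _ => by ring
  -- T1: per a, Σ_c Δ_ac (V̂Γ)_ac ≥ −Σ_c W_ac |(V̂Γ)_ac|
  have T1 : ∀ a, -(∑ c, W a c * |∑ c', V₀ a c' * Γ c' c|) ≤ ∑ c, (V a c - V₀ a c) * ∑ c', V₀ a c' * Γ c' c :=
    fun a => neg_sum_le_sum_mul (fun c => ∑ c', V₀ a c' * Γ c' c) (Δ a) (W a) (hΔb a)
  -- T2: Σ_a (Σ_c V₀_ac δ_c)(V̂γ)_a = Σ_c δ_c (V̂ᵀV̂γ)_c ≥ −Σ_c Wη_c |(V̂ᵀV̂γ)_c|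
  have T2eq : ∑ a, (∑ c, V₀ a c * (η c - η₀ c)) * ∑ c', V₀ a c' * γ c' = ∑ c, (η c - η₀ c) * ∑ a, V₀ a c * ∑ c', V₀ a c' * γ c' := by
    have h1 : ∀ a, (∑ c, V₀ a c * (η c - η₀ c)) * ∑ c', V₀ a c' * γ c' = ∑ c, (η c - η₀ c) * (V₀ a c * ∑ c', V₀ a c' * γ c') := by
      intro a; rw [Finset.sum_mul]; exact Finset.sum_congr rfl fun c _ => by ring
    rw [Finset.sum_congr rfl fun a _ => h1 a, Finset.sum_comm]
    exact Finset.sum_congr rfl fun c _ => by rw [Finset.mul_sum]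
  have T2 : -(∑ c, Wη c * |∑ a, V₀ a c * ∑ c', V₀ a c' * γ c'|) ≤ ∑ a, (∑ c, V₀ a c * (η c - η₀ c)) * ∑ c', V₀ a c' * γ c' := by
    rw [T2eq]; exact neg_sum_le_sum_mul _ _ _ hη
  -- T3: Σ_a (Σ_c Δ_ac δ_c)(V̂γ)_a ≥ −Σ_a |(V̂γ)_a| X_a
  have T3 : ∀ a, -(|∑ c, V₀ a c * γ c| * ∑ c, W a c * Wη c) ≤ (∑ c, Δ a c * (η c - η₀ c)) * ∑ c, V₀ a c * γ c := by
    intro a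
    have hb : |∑ c, Δ a c * (η c - η₀ c)| ≤ ∑ c, W a c * Wη c := by
      refine (abs_sum_le_sum_abs _ _).trans (Finset.sum_le_sum fun c _ => ?_)
      rw [abs_mul]; exact mul_le_mul (hΔb a c) (hη c) (abs_nonneg _) (hW a c)
    have h' : |(∑ c, Δ a c * (η c - η₀ c)) * ∑ c, V₀ a c * γ c| ≤ |∑ c, V₀ a c * γ c| * ∑ c, W a c * Wη c := by
      rw [abs_mul, mul_comm]; exact mul_le_mul_of_nonneg_left hb (abs_nonneg _)
    exact (abs_le.1 h').1
  -- T4: Σ_cc' Δ_ac Δ_ac' Γ_cc' ≥ −Σ_cc' W W |Γ|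
  have T4 : ∀ a, -(∑ c, ∑ c', W a c * W a c' * |Γ c c'|) ≤ ∑ c, ∑ c', (V a c - V₀ a c) * (V a c' - V₀ a c') * Γ c c' := by
    intro a
    rw [← Finset.sum_neg_distrib]
    refine Finset.sum_le_sum fun c _ => ?_
    rw [← Finset.sum_neg_distrib]
    refine Finset.sum_le_sum fun c' _ => ?_
    have h : |(V a c - V₀ a c) * (V a c' - V₀ a c') * Γ c c'| ≤ W a c * W a c' * |Γ c c'| := by
      rw [abs_mul, abs_mul]
      exact mul_le_mul_of_nonneg_right (mul_le_mul (hV a c) (hV a c') (abs_nonneg _) (hW a c)) (abs_nonneg _)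
    exact (abs_le.1 h).1
  -- T5: 2 K_a (Δγ)_a ≥ −2 Y_a Σ_c W_ac |γ_c|
  have T5 : ∀ a, -((∑ c, W a c * |γ c|) * Y a) ≤ K a * ∑ c, (V a c - V₀ a c) * γ c := by
    intro a
    have hb : |∑ c, (V a c - V₀ a c) * γ c| ≤ ∑ c, W a c * |γ c| := abs_sum_mul_le γ (Δ a) (W a) (hΔb a)
    have h' : |K a * ∑ c, (V a c - V₀ a c) * γ c| ≤ (∑ c, W a c * |γ c|) * Y a := by
      rw [abs_mul, mul_comm]; exact mul_le_mul hb (hKY a) (abs_nonneg _) ((abs_nonneg _).trans hb)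
    exact (abs_le.1 h').1
  -- T6: C K_a² ≥ −|C| Y_a²
  have T6 : ∀ a, -(|C| * Y a ^ 2) ≤ C * K a ^ 2 := by
    intro a
    have h1 : K a ^ 2 ≤ Y a ^ 2 := by
      calc K a ^ 2 = |K a| ^ 2 := (sq_abs _).symm
        _ ≤ Y a ^ 2 := pow_le_pow_left₀ (abs_nonneg _) (hKY a) 2
    have h2 : -|C| ≤ C := neg_abs_le C
    nlinarith [sq_nonneg (K a), abs_nonneg C]
  -- assemble per a, then sum
  have hper : ∀ a, -(2 * ∑ c, W a c * |∑ c', V₀ a c' * Γ c' c| + 2 * (|∑ c, V₀ a c * γ c| * ∑ c, W a c * Wη c)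
      + ∑ c, ∑ c', W a c * W a c' * |Γ c c'| + 2 * ((∑ c, W a c * |γ c|) * Y a) + |C| * Y a ^ 2)
      + 2 * ((∑ c, V₀ a c * (η c - η₀ c)) * ∑ c', V₀ a c' * γ c') ≤
      2 * ∑ c, (V a c - V₀ a c) * ∑ c', V₀ a c' * Γ c' c
        + 2 * (∑ c, V a c * (η c - η₀ c)) * ∑ c, V₀ a c * γ c
        + ∑ c, ∑ c', (V a c - V₀ a c) * (V a c' - V₀ a c') * Γ c c'
        + 2 * (∑ c, V a c * (η c - η₀ c)) * ∑ c, (V a c - V₀ a c) * γ c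
        + C * (∑ c, V a c * (η c - η₀ c)) ^ 2 := by
    intro a
    have e4 : (∑ c, V a c * (η c - η₀ c)) = K a := rfl
    have e2 : K a * ∑ c, V₀ a c * γ c =
        (∑ c, V₀ a c * (η c - η₀ c)) * ∑ c', V₀ a c' * γ c' + (∑ c, Δ a c * (η c - η₀ c)) * ∑ c, V₀ a c * γ c := by
      rw [hKsplit a]; ring
    rw [e4]
    linarith [T1 a, T3 a, T4 a, T5 a, T6 a, e2]
  have hsum := Finset.sum_le_sum fun a (_ : a ∈ (Finset.univ : Finset (Fin 3))) => hper a
  rw [Finset.sum_add_distrib] at hsum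
  have e5 : ∑ a, 2 * ((∑ c, V₀ a c * (η c - η₀ c)) * ∑ c', V₀ a c' * γ c') =
      2 * ∑ a, (∑ c, V₀ a c * (η c - η₀ c)) * ∑ c', V₀ a c' * γ c' := by rw [Finset.mul_sum]
  rw [e5] at hsum
  have hY' : ∀ a, Y a = ∑ c, (|V₀ a c| + W a c) * Wη c := fun a => rfl
  simp only [hY'] at hsum
  have e6 : ∑ a, -(2 * ∑ c, W a c * |∑ c', V₀ a c' * Γ c' c| + 2 * (|∑ c, V₀ a c * γ c| * ∑ c, W a c * Wη c)
      + ∑ c, ∑ c', W a c * W a c' * |Γ c c'| + 2 * ((∑ c, W a c * |γ c|) * ∑ c, (|V₀ a c| + W a c) * Wη c)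
      + |C| * (∑ c, (|V₀ a c| + W a c) * Wη c) ^ 2) =
      -(2 * ∑ a, ∑ c, W a c * |∑ c', V₀ a c' * Γ c' c| + 2 * ∑ a, |∑ c, V₀ a c * γ c| * ∑ c, W a c * Wη c
        + ∑ a, ∑ c, ∑ c', W a c * W a c' * |Γ c c'| + 2 * ∑ a, (∑ c, W a c * |γ c|) * ∑ c, (|V₀ a c| + W a c) * Wη c
        + |C| * ∑ a, (∑ c, (|V₀ a c| + W a c) * Wη c) ^ 2) := by
    simp only [Finset.sum_neg_distrib, Finset.sum_add_distrib, Finset.mul_sum]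
  rw [e6] at hsum
  linarith [hsum, T2]

end Summit.AtomisticToContinuum.Crystallization.Theorems.FrustratedLawDichotomyStrainedPatchHomLeafVectorForm

end
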